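import Mathlib.NumberTheory.NumberField.Basic
import Mathlib.RingTheory.RamificationInertia.Ramification
import Mathlib.RingTheory.DedekindDomain.Ideal.Lemmas
import Mathlib.FieldTheory.Finite.Basic
import Mathlib.LinearAlgebra.FreeModule.IdealQuotient
import HarnessLib

/-!
# X11b, S29 T6 (G3) part 1: THE FROBENIUS CONGRUENCE OF A NUMBER FIELD UNRAMIFIED ABOVE `p`

HONEST FRAMING (cell `b2b-bsdres`, run/shared/lean/b2b/bsd-rank1-residual/, verbatim in every
file): the goal of the cell is to DELETE the COMBINATION-SHAPED residual classes of the
Birch–Swinnerton-Dyer formula for ALL analytic-rank `≤ 1` elliptic curves over `ℚ` — assembled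
STRICTLY from published theorems — so that the rank-`≤ 1` remainder becomes exactly the
CONSTRUCTION-SHAPED classes, which are TYPED, NOT attempted. This is not "finishing BSD". Team N8/O2
(X11b at `3`: `3 ‖ N`, `r_an = 1`, `E[3]` irreducible); deal S29 (x11b3-lead GEN 8, OWNERS R9-8),
kernel lemma T6 (= G3, "`F` unramified above `p` ⇒ inertia fixes `ι⁻¹(F)`", dealt R9-42 / R9-43),
seat `b2b-bsdres-x11b3-p5` (gen. 6); consumer = K4-C's labelled binder `hUnr` (x11b3-p7, INBOX
l.5038). WORDING OF RECORD (H45, R9-8): S29 RE-EXPRESSES (t) ⟸ (VR); this file is an UNCONDITIONAL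
kernel lemma (algebraic number theory of a number field unramified above `p`) and SUPPLIES NOTHING
of the class record by itself; the node `Three.HsiehDescentAt₃` is UNCHANGED; O2 OPEN / N8
CONSTRUCTION; nothing booked. THEOREMS ONLY (no definition, no named fact, no `sorry`); valid for
EVERY prime `p` and every number field.

## What this file proves (the global half of T6's road "C", a contraction argument)

For a number field `K` and a prime `p` such that every prime `P ∋ p` of `𝓞 K` has ramification
index `1` — the hypothesis spelled EXACTLY as (VR-B)'s `F`-clause (r1 binder v3, p7 l.5038):
`∀ P : Ideal (𝓞 K), P.IsPrime → ((p : ℕ) : 𝓞 K) ∈ P → P.ramificationIdx (𝓞 ℚ) = 1` (Mathlib's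
length-based `Ideal.ramificationIdx`):

* `isMaximal_span_natCast_ringOfIntegers_rat`, `under_eq_span_of_mem`,
  `map_span_natCast_ringOfIntegers_rat` — `(p) ⊂ 𝓞 ℚ` is maximal, lies under every `P ∋ p`, and
  extends to `(p) ⊂ 𝓞 K`;
* `count_normalizedFactors_eq_one` — every prime factor of `(p) ⊂ 𝓞 K` has multiplicity `1`
  (`Ideal.IsDedekindDomain.ramificationIdx_eq_normalizedFactors_count`);
* `span_natCast_eq_prod`, `mem_span_natCast_of_forall_mem` — `p 𝓞 K = ∏_{P ∣ p} P` and
  `⋂_{P ∣ p} P ⊆ p 𝓞 K` (`IsDedekindDomain.inf_pow_eq_prod_of_prime`);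
* `exists_forall_pow_prime_pow_mul_sub_mem` — in the finite field `𝓞 K / P` (`#= p^{n_P}`):
  `x ^ {p^{n_P m}} ≡ x (mod P)` (`FiniteField.pow_card_pow`);
* **`exists_pow_prime_pow_sub_mem_span`** — THE FROBENIUS CONGRUENCE: `∃ f ≥ 1, ∀ x ∈ 𝓞 K,
  x ^ {p^f} − x ∈ p 𝓞 K` (`f = ∏_P n_P`).

The local half and the export of T6 are in `X11b/UnramifiedInertiaFixed.lean`.

References: J. Neukirch, *Algebraic Number Theory*, Ch. I §8, (8.3) [`NeukirchANT1999`];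
J.-P. Serre, *Local Fields*, Ch. I §8 [`SerreLocalFields1979`]. Cell files: `cells/x11b3/OWNERS.md`
R9-42 / R9-43; road memo `HOME/b2b-bsdres-x11b3-p3/gen7/T6-ROAD.md` (a different road; this file's
road C is the owner's, INBOX l.5143).
-/

noncomputable section

open scoped NumberField
open Ideal UniqueFactorizationMonoid

namespace Summit.BirchSwinnertonDyer.Rank1Residual.X11b.UnramifiedInertia

variable (p : ℕ) [Fact p.Prime]

/-- `(p) ⊂ 𝓞 ℚ` is a maximal ideal (`p` is prime in `𝓞 ℚ ≅ ℤ`, a Dedekind domain). [folklore] -/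
theorem isMaximal_span_natCast_ringOfIntegers_rat :
    (Ideal.span {((p : ℕ) : 𝓞 ℚ)}).IsMaximal := by
  have hp : Prime ((p : ℕ) : 𝓞 ℚ) := by
    have h1 : Prime ((p : ℕ) : ℤ) := Nat.prime_iff_prime_int.mp Fact.out
    have h2 : (Rat.ringOfIntegersEquiv.symm : ℤ ≃+* 𝓞 ℚ) (p : ℤ) = ((p : ℕ) : 𝓞 ℚ) := by
      simp
    rw [← h2]
    exact (MulEquiv.prime_iff (Rat.ringOfIntegersEquiv.symm : ℤ ≃+* 𝓞 ℚ).toMulEquiv).mpr h1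
  have hne : Ideal.span {((p : ℕ) : 𝓞 ℚ)} ≠ ⊥ := by
    rw [Ne, Ideal.span_singleton_eq_bot]
    exact hp.ne_zero
  exact ((Ideal.span_singleton_prime hp.ne_zero).mpr hp).isMaximal hne

variable (K : Type*) [Field K] [NumberField K]

/-- A prime `P` of `𝓞 K` containing `p` lies over `(p) ⊂ 𝓞 ℚ`: `P ∩ 𝓞 ℚ = (p)`. [folklore] -/
theorem under_eq_span_of_mem {P : Ideal (𝓞 K)} [P.IsPrime] (hpP : ((p : ℕ) : 𝓞 K) ∈ P) :
    P.under (𝓞 ℚ) = Ideal.span {((p : ℕ) : 𝓞 ℚ)} := by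
  refine ((isMaximal_span_natCast_ringOfIntegers_rat p).eq_of_le
    (Ideal.IsPrime.ne_top inferInstance) ?_).symm
  rw [Ideal.span_le, Set.singleton_subset_iff, SetLike.mem_coe, Ideal.mem_comap, map_natCast]
  exact hpP

omit [Fact p.Prime] in
/-- `(p) ⊂ 𝓞 ℚ` extends to `(p) ⊂ 𝓞 K`. [folklore] -/
theorem map_span_natCast_ringOfIntegers_rat :
    (Ideal.span {((p : ℕ) : 𝓞 ℚ)}).map (algebraMap (𝓞 ℚ) (𝓞 K)) =
      Ideal.span {((p : ℕ) : 𝓞 K)} := by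
  rw [Ideal.map_span, Set.image_singleton, map_natCast]

/-- **Every prime factor of `p 𝓞 K` is simple** when every `P ∋ p` has ramification index `1`:
the multiplicity of `P` in `(p)` is `e(P ∣ p)`
(`Ideal.IsDedekindDomain.ramificationIdx_eq_normalizedFactors_count`).
Ref: Neukirch, *Algebraic Number Theory*, Ch. I (8.3). [cite: NeukirchANT1999, Ch. I §8 (8.3)] -/
theorem count_normalizedFactors_eq_one
    (hunr : ∀ P : Ideal (𝓞 K), P.IsPrime → ((p : ℕ) : 𝓞 K) ∈ P → P.ramificationIdx (𝓞 ℚ) = 1)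
    {P : Ideal (𝓞 K)}
    (hP : P ∈ normalizedFactors (Ideal.span {((p : ℕ) : 𝓞 K)})) :
    Multiset.count P (normalizedFactors (Ideal.span {((p : ℕ) : 𝓞 K)})) = 1 := by
  classical
  have hI0 : Ideal.span {((p : ℕ) : 𝓞 K)} ≠ ⊥ := by
    rw [Ne, Ideal.span_singleton_eq_bot]
    exact_mod_cast (Fact.out : p.Prime).ne_zero
  have hPprime : P.IsPrime := Ideal.isPrime_of_prime (prime_of_normalized_factor P hP)
  have hle : Ideal.span {((p : ℕ) : 𝓞 K)} ≤ P :=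
    Ideal.le_of_dvd (dvd_of_mem_normalizedFactors hP)
  have hpP : ((p : ℕ) : 𝓞 K) ∈ P := hle (Ideal.subset_span rfl)
  haveI := hPprime
  haveI : P.LiesOver (Ideal.span {((p : ℕ) : 𝓞 ℚ)}) := ⟨(under_eq_span_of_mem p K hpP).symm⟩
  have h := Ideal.IsDedekindDomain.ramificationIdx_eq_normalizedFactors_count
    (Ideal.span {((p : ℕ) : 𝓞 ℚ)}) P (by rw [map_span_natCast_ringOfIntegers_rat]; exact hI0)
  rw [map_span_natCast_ringOfIntegers_rat] at h
  rw [← h]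
  exact hunr P hPprime hpP

/-- **`p 𝓞 K = ∏_{P ∣ p} P`** (product over the DISTINCT prime factors) when every `P ∋ p` has
ramification index `1`. Ref: Neukirch, *Algebraic Number Theory*, Ch. I (8.3) (`p𝓞 = ∏ P^{e_P}`).
[cite: NeukirchANT1999, Ch. I §8 (8.3)] -/
theorem span_natCast_eq_prod
    (hunr : ∀ P : Ideal (𝓞 K), P.IsPrime → ((p : ℕ) : 𝓞 K) ∈ P → P.ramificationIdx (𝓞 ℚ) = 1) :
    Ideal.span {((p : ℕ) : 𝓞 K)} =
      ∏ P ∈ (normalizedFactors (Ideal.span {((p : ℕ) : 𝓞 K)})).toFinset, P := by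
  classical
  set I : Ideal (𝓞 K) := Ideal.span {((p : ℕ) : 𝓞 K)} with hI
  have hI0 : I ≠ ⊥ := by
    rw [hI, Ne, Ideal.span_singleton_eq_bot]
    exact_mod_cast (Fact.out : p.Prime).ne_zero
  have hprod : (normalizedFactors I).prod = I :=
    associated_iff_eq.mp (prod_normalizedFactors hI0)
  conv_lhs => rw [← hprod]
  rw [Finset.prod_multiset_count]
  refine Finset.prod_congr rfl fun P hP => ?_
  rw [count_normalizedFactors_eq_one p K hunr (Multiset.mem_toFinset.mp hP), pow_one]

/-- Under the same hypothesis, **an element lying in every prime `P ∣ p` lies in `p 𝓞 K`**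
(`⋂ P = ∏ P` for distinct primes of a Dedekind domain, `IsDedekindDomain.inf_pow_eq_prod_of_prime`).
[cite: NeukirchANT1999, Ch. I §8 (8.3)] -/
theorem mem_span_natCast_of_forall_mem
    (hunr : ∀ P : Ideal (𝓞 K), P.IsPrime → ((p : ℕ) : 𝓞 K) ∈ P → P.ramificationIdx (𝓞 ℚ) = 1)
    {y : 𝓞 K}
    (hy : ∀ P ∈ (normalizedFactors (Ideal.span {((p : ℕ) : 𝓞 K)})).toFinset, y ∈ P) :
    y ∈ Ideal.span {((p : ℕ) : 𝓞 K)} := by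
  classical
  set T := (normalizedFactors (Ideal.span {((p : ℕ) : 𝓞 K)})).toFinset with hT
  have hinf : (T.inf fun P => P ^ 1) = ∏ P ∈ T, P ^ 1 := by
    refine IsDedekindDomain.inf_pow_eq_prod_of_prime T (fun P => P) (fun _ => 1) ?_ ?_
    · intro P hP
      exact prime_of_normalized_factor P (Multiset.mem_toFinset.mp hP)
    · intro P _ Q _ hPQ
      exact hPQ
  rw [span_natCast_eq_prod p K hunr]
  have hmem : y ∈ T.inf fun P => P ^ 1 := by
    refine Submodule.mem_finsetInf.mpr fun P hP => ?_
    rw [pow_one]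
    exact hy P hP
  rw [hinf] at hmem
  simpa only [pow_one] using hmem

omit [Fact p.Prime] in
/-- **Frobenius congruence at one prime**: for a non-zero prime `P ∋ p` of `𝓞 K` there is `n ≥ 1`
(`#(𝓞 K / P) = p ^ n`, `FiniteField.card`) with `x ^ (p ^ (n m)) ≡ x (mod P)` for all `x` and `m`
(`FiniteField.pow_card_pow` in the finite field `𝓞 K / P`). [folklore] -/
theorem exists_forall_pow_prime_pow_mul_sub_mem (hp : p.Prime) {P : Ideal (𝓞 K)} [hP : P.IsPrime]
    (hP0 : P ≠ ⊥) (hpP : ((p : ℕ) : 𝓞 K) ∈ P) :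
    ∃ n : ℕ, 0 < n ∧ ∀ (m : ℕ) (x : 𝓞 K), x ^ p ^ (n * m) - x ∈ P := by
  classical
  haveI : P.IsMaximal := hP.isMaximal hP0
  haveI : Finite (𝓞 K ⧸ P) := Ideal.finiteQuotientOfFreeOfNeBot P hP0
  letI : Fintype (𝓞 K ⧸ P) := Fintype.ofFinite _
  letI : Field (𝓞 K ⧸ P) := Ideal.Quotient.field P
  have hchar : CharP (𝓞 K ⧸ P) p := by
    refine (CharP.charP_iff_prime_eq_zero hp).mpr ?_
    rw [← map_natCast (Ideal.Quotient.mk P), Ideal.Quotient.eq_zero_iff_mem]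
    exact hpP
  obtain ⟨n, -, hcard⟩ := FiniteField.card (𝓞 K ⧸ P) p
  refine ⟨n, n.pos, fun m x => ?_⟩
  rw [← Ideal.Quotient.eq_zero_iff_mem, map_sub, map_pow, sub_eq_zero, pow_mul, ← hcard]
  exact FiniteField.pow_card_pow m _

/-- **THE FROBENIUS CONGRUENCE of a number field unramified above `p`.**  Let `K` be a number
field such that every prime `P` of `𝓞 K` above `p` has ramification index `e(P ∣ p) = 1`
(the hypothesis is spelled exactly as (VR-B)'s `F`-clause: `P.ramificationIdx (𝓞 ℚ) = 1` for
every prime `P ∋ p`, Mathlib's length-based `Ideal.ramificationIdx`).  Then there is `f ≥ 1` with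
`x ^ (p ^ f) ≡ x (mod p 𝓞 K)` for EVERY `x ∈ 𝓞 K`: `p 𝓞 K = ∏_{P ∣ p} P` is a product of
DISTINCT primes (the multiplicity of `P` in `(p)` is `e(P ∣ p) = 1`,
`Ideal.IsDedekindDomain.ramificationIdx_eq_normalizedFactors_count`), `x ^ {p^{n_P m}} ≡ x (mod P)`
in the finite field `𝓞 K / P` of order `p ^ {n_P}` (`FiniteField.pow_card_pow`), take
`f = ∏_P n_P`, and `⋂_{P ∣ p} P = ∏_{P ∣ p} P` (`IsDedekindDomain.inf_pow_eq_prod_of_prime`).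
Equivalently: `𝓞 K / p` is reduced and its Frobenius has finite order.
Ref: Neukirch, *Algebraic Number Theory*, Ch. I (8.3) (`p 𝓞 K = ∏ P^{e_P}`); Serre, *Local Fields*,
Ch. I §8. [cite: NeukirchANT1999, Ch. I §8 (8.3)] -/
theorem exists_pow_prime_pow_sub_mem_span
    (hunr : ∀ P : Ideal (𝓞 K), P.IsPrime → ((p : ℕ) : 𝓞 K) ∈ P → P.ramificationIdx (𝓞 ℚ) = 1) :
    ∃ f : ℕ, 0 < f ∧ ∀ x : 𝓞 K, x ^ p ^ f - x ∈ Ideal.span {((p : ℕ) : 𝓞 K)} := by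
  classical
  set T := (normalizedFactors (Ideal.span {((p : ℕ) : 𝓞 K)})).toFinset with hT
  have hper : ∀ P ∈ T, ∃ n : ℕ, 0 < n ∧ ∀ (m : ℕ) (x : 𝓞 K), x ^ p ^ (n * m) - x ∈ P := by
    intro P hP
    have hP' := Multiset.mem_toFinset.mp hP
    haveI : P.IsPrime := Ideal.isPrime_of_prime (prime_of_normalized_factor P hP')
    have hP0 : P ≠ ⊥ := (prime_of_normalized_factor P hP').ne_zero
    have hle : Ideal.span {((p : ℕ) : 𝓞 K)} ≤ P :=
      Ideal.le_of_dvd (dvd_of_mem_normalizedFactors hP')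
    exact exists_forall_pow_prime_pow_mul_sub_mem p K Fact.out hP0 (hle (Ideal.subset_span rfl))
  choose! n hn hcong using hper
  refine ⟨∏ P ∈ T, n P, Finset.prod_pos fun P hP => hn P hP, fun x => ?_⟩
  refine mem_span_natCast_of_forall_mem p K hunr fun P hP => ?_
  obtain ⟨m, hm⟩ : n P ∣ ∏ Q ∈ T, n Q := Finset.dvd_prod_of_mem n hP
  rw [hm]
  exact hcong P hP m x

end Summit.BirchSwinnertonDyer.Rank1Residual.X11b.UnramifiedInertia
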